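import Literature.NumberTheory.DiophantineApproximation.PolylogTwoPointLinearIndependence
import Literature.NumberTheory.DiophantineApproximation.PolylogTwoPointHermitePadeRationalSeries
import Literature.NumberTheory.DiophantineApproximation.PolylogTwoPointHermitePadeRationalForms
import HarnessLib

/-!
# Linear independence of `1, Li_s(a/b), Θ_s(a/b)` (`s ≤ w`) over `ℚ` for `log b ≥ 8(w+1)³ + 4w log a`

Topic `Literature/NumberTheory/DiophantineApproximation`. The rational-point case of
`PolylogTwoPointLinearIndependence.lean`: for every weight `w ≥ 1`, every `a ≥ 1` and every integer
`b` with `log b ≥ 8 (w + 1)³ + 4 w log a`, the `2w + 1` real numbers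

  `1`,  `L_s = Li_s(a/b) = ∑_{k≥1} (a/b)^k/k^s`,  `T_s = Θ_s(a/b) = ∑_{k≥0} (a/b)^{k+1}/(2k+1)^s`  (`1 ≤ s ≤ w`)

are linearly independent over `ℚ` (`ParityPade.intRelation_trivial_rat`, integer coefficients;
`one_polylog_oddPolylog_linearIndependent_rat`, rational coefficients). With `a/b = (M/N)²` and the
parity bridge `Li_s(±M/N) = 2^{−s} Li_s(M²/N²) ± (N/M) Θ_s(M²/N²)` this is the two-point case
`α = (1, −1)` of David–Hirata-Kohno–Kawashima 2020, Thm 2.1 at the rational points `±M/N` (drawn in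
`PolylogTwoPointsLinearIndependenceRational.lean`); the threshold is crude (no attempt at optimality).
-- TODO(general form): algebraic points and the thresholds `V > 0` of [DavidHirataKohnoKawashima2020, Thm 2.1].

## Proof

As in the integer case, with `y = a/b` and the INTEGER forms
`ℓ_n = d_n^w a^{n/2} 2^w Λ^{(w)}_n(a/b) = p_n + ∑_o q_{n,o} L_{o+1} + ∑_o q'_{n,o} T_{o+1}`
(`PolylogTwoPointHermitePadeRationalSeries.lean`, `PolylogTwoPointHermitePadeRationalForms.lean`; the
extra factor `a^{n/2}`, natural division, clears the denominators). With `L = log b − log a`,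
`l_a = log a ≥ 0`, `κ_w ≤ w + 1` and `δ = 1/8` the rates become
`A₂ = wL − l_a/2 − 2w log 2 − w − 2δ` (from `Λ_n ≤ (4y)^{wn}`, `a^{n/2} ≤ e^{(l_a/2) n}`,
`d_n^w ≤ e^{(w+δ)n}`), `A₁ = wL + κ_w + 2δ` and `B = (L + l_a)/2 + w(2w+3) log 2 + w + 2δ` (from
`|q_{n,o}| ≤ d_n^w (∑|c|) 2^w b^{n/2}`, `log b = L + l_a`). The two gap conditions of the reduction
`relation_trivial_of_small_forms` / transference `no_integer_forms` in dimension `2w − 1` follow from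
the integer-case numerics `ParityPade.gap_inequalities_parity` applied at `L − (4w−1) l_a ≥ 8(w+1)³`
by linear algebra (the `l_a`-terms cancel exactly in the second condition).

References: S. David, N. Hirata-Kohno, M. Kawashima, Moscow J. Comb. Number Th. 9 (2020), Thm 2.1;
E. M. Nikišin, Mat. Sb. 109 (1979); M. Hata, J. Math. Pures Appl. 69 (1990);
Yu. V. Nesterenko, Vestnik MGU (1985) (the criterion).
-/

noncomputable section

open Finset Filter Real

namespace Literature.NumberTheory.DiophantineApproximation

namespace ParityPade

open _root_.Filter _root_.Topology
open Literature.NumberTheory.Transcendental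

/-- **No integer relation among `1, Li_s(a/b), Θ_s(a/b)` (`s ≤ w`)** for `w ≥ 1`, `a ≥ 1` and
`log b ≥ 8(w+1)³ + 4w log a`: if `a₀ + ∑_{j<w} b_j L_{j+1} + ∑_{j<w} c_j T_{j+1} = 0` with integers
`a₀, b_j, c_j` (`L_s = DilogPade.polylogSeries s (a/b)`, `T_s = oddPolylogSeries s (a/b)`), then all of
them vanish. [cite: DavidHirataKohnoKawashima2020, Thm 2.1] -/
theorem intRelation_trivial_rat (w : ℕ) (hw : 1 ≤ w) (a b : ℕ) (ha : 1 ≤ a)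
    (hb : 8 * ((w : ℝ) + 1) ^ 3 + 4 * w * Real.log a ≤ Real.log b)
    (a₀ : ℤ) (bc cc' : Fin w → ℤ)
    (h : (a₀ : ℝ) + ∑ j : Fin w, (bc j : ℝ) * DilogPade.polylogSeries ((j : ℕ) + 1) ((a : ℝ) / b) +
      ∑ j : Fin w, (cc' j : ℝ) * oddPolylogSeries ((j : ℕ) + 1) ((a : ℝ) / b) = 0) :
    a₀ = 0 ∧ bc = 0 ∧ cc' = 0 := by
  classical
  obtain ⟨k, rfl⟩ : ∃ k, w = k + 1 := ⟨w - 1, by omega⟩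
  -- `a ≥ 1`, `b ≥ 4a`, `y = a/b ∈ (0, 1/2]`
  have hwr : (1 : ℝ) ≤ ((k + 1 : ℕ) : ℝ) := by exact_mod_cast hw
  have haR : (1 : ℝ) ≤ a := by exact_mod_cast ha
  have hapos : (0 : ℝ) < a := by linarith
  have hlA0 : 0 ≤ Real.log a := Real.log_nonneg haR
  have hL3 : (64 : ℝ) + Real.log a ≤ Real.log b := by
    have h2 : (2 : ℝ) ≤ ((k + 1 : ℕ) : ℝ) + 1 := by linarith
    have h3 : (64 : ℝ) ≤ 8 * (((k + 1 : ℕ) : ℝ) + 1) ^ 3 := by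
      calc (64 : ℝ) = 8 * 2 ^ 3 := by norm_num
        _ ≤ 8 * (((k + 1 : ℕ) : ℝ) + 1) ^ 3 := by gcongr
    have h4 : Real.log a ≤ 4 * ((k + 1 : ℕ) : ℝ) * Real.log a := by nlinarith
    linarith
  have hb0 : (b : ℝ) ≠ 0 := by
    intro h0; rw [h0, Real.log_zero] at hL3; linarith
  have hbpos : (0 : ℝ) < b := lt_of_le_of_ne (Nat.cast_nonneg b) (Ne.symm hb0)
  have hb4a : 4 * (a : ℝ) ≤ b := by
    -- `log (b/a) ≥ 64 > log 4`
    by_contra hlt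
    push Not at hlt
    have h1 : Real.log b < Real.log (4 * a) := Real.log_lt_log hbpos hlt
    rw [Real.log_mul (by norm_num) hapos.ne'] at h1
    have h4 : Real.log 4 ≤ (4 : ℝ) - 1 := Real.log_le_sub_one_of_pos (by norm_num)
    linarith
  have hab2 : 2 * a ≤ b := by exact_mod_cast (show (2 : ℝ) * a ≤ b by linarith)
  have hab : a ≤ b := le_trans (Nat.le_mul_of_pos_left a two_pos) hab2
  have hb1 : 1 ≤ b := le_trans ha hab
  have hx0 : (0 : ℝ) < (a : ℝ) / b := by positivity
  have hx1 : (a : ℝ) / b ≤ 1 / 2 := by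
    rw [div_le_iff₀ hbpos]; linarith
  have hx1' : (a : ℝ) / b < 1 := by linarith
  -- the constants (opaque, with defining equations, for `linarith`)
  obtain ⟨wr, hwrdef⟩ : ∃ wr : ℝ, wr = ((k + 1 : ℕ) : ℝ) := ⟨_, rfl⟩
  obtain ⟨l2, hl2def⟩ : ∃ l2 : ℝ, l2 = Real.log 2 := ⟨_, rfl⟩
  obtain ⟨lA, hlAdef⟩ : ∃ lA : ℝ, lA = Real.log a := ⟨_, rfl⟩
  obtain ⟨L, hLdef⟩ : ∃ L : ℝ, L = Real.log b - Real.log a := ⟨_, rfl⟩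
  obtain ⟨κ, hκdef⟩ : ∃ κ : ℝ,
      κ = wr * ((2 * wr + 1) * Real.log ((2 * wr + 1) / (2 * wr)) - l2) := ⟨_, rfl⟩
  obtain ⟨cw, hcwdef⟩ : ∃ cw : ℝ, cw = wr * (2 * wr + 3) * l2 := ⟨_, rfl⟩
  obtain ⟨δ, hδdef⟩ : ∃ δ : ℝ, δ = 1 / 8 := ⟨_, rfl⟩
  have hwr1 : 1 ≤ wr := by rw [hwrdef]; exact hwr
  have hwrk : wr = (k : ℝ) + 1 := by rw [hwrdef]; push_cast; ring
  have hwrpos : 0 < wr := by linarith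
  have hδ : (0 : ℝ) < δ := by rw [hδdef]; norm_num
  have hlA : 0 ≤ lA := by rw [hlAdef]; exact hlA0
  have hl40 : (69 : ℝ) / 50 ≤ 2 * l2 := by
    rw [hl2def]
    have h1 := Real.log_two_gt_d9
    norm_num at h1 ⊢
    linarith
  have hl41 : 2 * l2 ≤ (139 : ℝ) / 100 := by
    rw [hl2def]
    have h1 := Real.log_two_lt_d9
    norm_num at h1 ⊢
    linarith
  have hl2pos : 0 < l2 := by linarith only [hl40]
  have hlogb : Real.log (b : ℝ) = L + lA := by rw [hLdef, hlAdef]; ring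
  have hbw : 8 * (wr + 1) ^ 3 + 4 * wr * lA ≤ L + lA := by
    have := hb
    rw [← hwrdef, ← hlAdef, hlogb] at this
    exact this
  have hL : 8 * (wr + 1) ^ 3 ≤ L - (4 * wr - 1) * lA := by
    have e2 : L - (4 * wr - 1) * lA = (L + lA) - 4 * wr * lA := by ring
    rw [e2]
    linarith [hbw]
  -- `0 ≤ κ ≤ wr + 1` from `x/(1+x) ≤ log(1+x) ≤ x` at `x = 1/(2wr)`
  have hratio : (2 * wr + 1) / (2 * wr) = 1 + 1 / (2 * wr) := by field_simp
  have hlog_le : Real.log ((2 * wr + 1) / (2 * wr)) ≤ 1 / (2 * wr) := by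
    have h1 := Real.log_le_sub_one_of_pos (show (0 : ℝ) < (2 * wr + 1) / (2 * wr) by positivity)
    rw [hratio] at h1 ⊢
    linarith only [h1]
  have hlog_ge : l2 / (2 * wr + 1) ≤ Real.log ((2 * wr + 1) / (2 * wr)) := by
    have hpos : (0 : ℝ) < (2 * wr + 1) / (2 * wr) := by positivity
    have h1 : 1 - ((2 * wr + 1) / (2 * wr))⁻¹ ≤ Real.log ((2 * wr + 1) / (2 * wr)) :=
      Real.one_sub_inv_le_log_of_pos hpos
    have h2 : 1 - ((2 * wr + 1) / (2 * wr))⁻¹ = 1 / (2 * wr + 1) := by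
      field_simp
      ring
    rw [h2] at h1
    have h3 : l2 / (2 * wr + 1) ≤ 1 / (2 * wr + 1) :=
      div_le_div_of_nonneg_right (by linarith only [hl41]) (by positivity)
    exact h3.trans h1
  have hκ0 : 0 ≤ κ := by
    rw [hκdef]
    refine mul_nonneg hwrpos.le ?_
    have e : (2 * wr + 1) * (l2 / (2 * wr + 1)) = l2 := by field_simp
    have hh := mul_le_mul_of_nonneg_left hlog_ge (show (0:ℝ) ≤ 2 * wr + 1 by positivity)
    rw [e] at hh
    linarith only [hh]
  have hκ1 : κ ≤ wr + 1 := by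
    rw [hκdef]
    have h1 : (2 * wr + 1) * Real.log ((2 * wr + 1) / (2 * wr)) ≤ (2 * wr + 1) * (1 / (2 * wr)) :=
      mul_le_mul_of_nonneg_left hlog_le (by positivity)
    have h2 : (2 * wr + 1) * (1 / (2 * wr)) = 1 + 1 / (2 * wr) := by field_simp
    have h3 : wr * (1 + 1 / (2 * wr) - l2) = wr + 1 / 2 - wr * l2 := by field_simp
    calc wr * ((2 * wr + 1) * Real.log ((2 * wr + 1) / (2 * wr)) - l2)
        ≤ wr * (1 + 1 / (2 * wr) - l2) := by
          refine mul_le_mul_of_nonneg_left ?_ hwrpos.le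
          linarith only [h1, h2]
      _ = wr + 1 / 2 - wr * l2 := h3
      _ ≤ wr + 1 := by linarith only [mul_pos hwrpos hl2pos]
  have hcw0 : 0 ≤ cw := by rw [hcwdef]; positivity
  have hcw1 : cw ≤ 7 / 10 * wr * (2 * wr + 3) := by
    have hP : 0 < wr * (2 * wr + 3) := mul_pos hwrpos (by linarith only [hwr1])
    have hh : wr * (2 * wr + 3) * l2 ≤ wr * (2 * wr + 3) * (7 / 10) :=
      mul_le_mul_of_nonneg_left (by linarith only [hl41]) hP.le
    have e : 7 / 10 * wr * (2 * wr + 3) = wr * (2 * wr + 3) * (7 / 10) := by ring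
    rw [hcwdef, e]
    exact hh
  have hwlA : 0 ≤ wr * lA := mul_nonneg hwrpos.le hlA
  have hLpos : 0 < L := by
    have h3 := pow_pos (show (0:ℝ) < wr + 1 by linarith only [hwr1]) 3
    have h4 : 0 ≤ (4 * wr - 1) * lA := mul_nonneg (by linarith only [hwr1]) hlA
    linarith only [hL, h3, h4]
  -- powers as exponentials in the opaque constants
  have hlogy : Real.log ((a : ℝ) / b) = -L := by
    rw [hLdef, Real.log_div hapos.ne' hb0]; ring
  have hypow : ∀ m : ℕ, ((a : ℝ) / b) ^ m = Real.exp (-(L * m)) := fun m => by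
    rw [DilogPade.pow_eq_exp_log_mul hx0 m, hlogy]; ring_nf
  have hbpow : ∀ m : ℕ, (b : ℝ) ^ m = Real.exp ((L + lA) * m) := fun m => by
    rw [DilogPade.pow_eq_exp_log_mul hbpos m, hlogb]
  have hapow : ∀ m : ℕ, (a : ℝ) ^ m = Real.exp (lA * m) := fun m => by
    rw [DilogPade.pow_eq_exp_log_mul hapos m, hlAdef]
  have h2pow : ∀ m : ℕ, (2 : ℝ) ^ m = Real.exp (l2 * m) := fun m => by
    rw [hl2def]; exact DilogPade.pow_eq_exp_log_mul two_pos m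
  have h4pow : ∀ m : ℕ, (4 : ℝ) ^ m = Real.exp (2 * l2 * m) := fun m => by
    rw [show (4 : ℝ) = 2 ^ 2 by norm_num, ← pow_mul, h2pow]
    congr 1
    push_cast
    ring
  -- the gap inequalities: the integer-case numerics at `L − (4w−1) l_a`, then linear algebra
  obtain ⟨g0', g1', g2'⟩ := gap_inequalities_parity (L := L - (4 * wr - 1) * lA)
    hwr1 hδdef hκ0 hκ1 hcw0 hcw1 hl40 hl41 hL
  have hq1 : 0 ≤ (4 * wr ^ 2 - wr - 1 / 2) * lA := by
    refine mul_nonneg ?_ hlA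
    have h5 : 0 ≤ (wr - 1) * (4 * wr + 3) :=
      mul_nonneg (by linarith only [hwr1]) (by linarith only [hwr1])
    have e : 4 * wr ^ 2 - wr - 1 / 2 = (wr - 1) * (4 * wr + 3) + 5 / 2 := by ring
    rw [e]
    linarith only [h5]
  have hq2 : 0 ≤ (wr - 1 / 2) * lA := mul_nonneg (by linarith only [hwr1]) hlA
  have eR : wr * (L - (4 * wr - 1) * lA) - wr * (2 * l2) - wr - 2 * δ =
      (wr * L - lA / 2 - wr * (2 * l2) - wr - 2 * δ) - (4 * wr ^ 2 - wr - 1 / 2) * lA := by ring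
  have eB : (2 * wr - 1) * ((L - (4 * wr - 1) * lA) / 2 + cw + wr + 2 * δ) =
      (2 * wr - 1) * ((L + lA) / 2 + cw + wr + 2 * δ) - (4 * wr ^ 2 - 2 * wr) * lA := by ring
  have eS : (4 * wr ^ 2 - wr - 1 / 2) * lA = (4 * wr ^ 2 - 2 * wr) * lA + (wr - 1 / 2) * lA := by ring
  have eA : (2 * wr - 1) * ((wr * (L - (4 * wr - 1) * lA) + κ + 2 * δ) +
      ((L - (4 * wr - 1) * lA) / 2 + cw + wr + 2 * δ)) =
      (2 * wr - 1) * ((wr * L + κ + 2 * δ) + ((L + lA) / 2 + cw + wr + 2 * δ)) -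
        (8 * wr ^ 3 - 2 * wr ^ 2 - wr) * lA := by ring
  have eA' : (2 * wr - 1 + 1) * (wr * (L - (4 * wr - 1) * lA) - wr * (2 * l2) - wr - 2 * δ) =
      (2 * wr - 1 + 1) * (wr * L - lA / 2 - wr * (2 * l2) - wr - 2 * δ) -
        (8 * wr ^ 3 - 2 * wr ^ 2 - wr) * lA := by ring
  rw [eR] at g0'
  rw [eB, eR] at g1'
  rw [eA, eA'] at g2'
  have g0 : 0 < wr * L - lA / 2 - wr * (2 * l2) - wr - 2 * δ := by linarith only [g0', hq1]
  have g1 : (2 * wr - 1) * ((L + lA) / 2 + cw + wr + 2 * δ) <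
      wr * L - lA / 2 - wr * (2 * l2) - wr - 2 * δ := by linarith only [g1', hq2, eS]
  have g2 : (2 * wr - 1) * ((wr * L + κ + 2 * δ) + ((L + lA) / 2 + cw + wr + 2 * δ)) <
      (2 * wr - 1 + 1) * (wr * L - lA / 2 - wr * (2 * l2) - wr - 2 * δ) := by linarith only [g2']
  have hwl2 : 0 ≤ wr * (2 * l2) := mul_nonneg hwrpos.le (by linarith only [hl2pos])
  have gA : wr * L - lA / 2 - wr * (2 * l2) - wr - 2 * δ ≤ wr * L + κ + 2 * δ := by
    linarith only [hwl2, hκ0, hδ, hwrpos, hlA]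
  have gB : (0 : ℝ) ≤ (L + lA) / 2 + cw + wr + 2 * δ := by linarith only [hLpos, hlA, hcw0, hwrpos, hδ]
  have hkk : (((k + 1) + k : ℕ) : ℝ) = 2 * wr - 1 := by rw [hwrk]; push_cast; ring
  -- the numbers: `Lv j = L_{j+1}`, `Tv j = T_{j+1}`, `θ = (Lv, Tv)` on `Fin ((k+1)+(k+1))`
  set Lv : Fin (k + 1) → ℝ := fun j => DilogPade.polylogSeries ((j : ℕ) + 1) ((a : ℝ) / b) with hLv
  set Tv : Fin (k + 1) → ℝ := fun j => oddPolylogSeries ((j : ℕ) + 1) ((a : ℝ) / b) with hTv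
  set θ : Fin ((k + 1) + (k + 1)) → ℝ := Fin.append Lv Tv with hθ
  -- the relation, on `θ`
  set cc : Fin ((k + 1) + (k + 1) + 1) → ℤ := Fin.cons a₀ (Fin.append bc cc') with hcc
  have h' : (cc 0 : ℝ) + ∑ j : Fin ((k + 1) + (k + 1)), (cc j.succ : ℝ) * θ j = 0 := by
    have e1 : ∑ j : Fin ((k + 1) + (k + 1)), (cc j.succ : ℝ) * θ j =
        ∑ j : Fin (k + 1), (bc j : ℝ) * Lv j + ∑ j : Fin (k + 1), (cc' j : ℝ) * Tv j := by
      rw [Fin.sum_univ_add]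
      simp only [hcc, hθ, Fin.cons_succ, Fin.append_left, Fin.append_right]
    rw [e1]
    simpa [hcc, hLv, hTv, add_assoc] using h
  -- the partial-fraction data of the kernels, and the integer forms
  choose cf hcf using fun n => exists_pf_kernelH (k + 1) n hw
  have hev : ∀ n (u : ℕ), kernelH (k + 1) n u = BallRivoal.pfEval n (k + 1) (cf n) (2 * u) := by
    intro n u
    refine ((hcf n).1 u fun m _ => ?_).symm
    have : (0 : ℚ) < 2 * (u : ℚ) + m + 1 := by positivity
    exact this.ne'
  have hint : ∀ n, BallRivoal.IsInt (k + 1) (Nat.lcmUpto n) (cf n) := fun n => (hcf n).2.1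
  have hl1 : ∀ n, BallRivoal.l1 n (k + 1) (cf n) ≤ ((k + 1).factorial : ℚ) *
      ∏ s ∈ range (k + 1), (2 : ℚ) ^ ((2 * s + 5) * n + 1) := fun n => (hcf n).2.2
  choose qL hqL using fun n (j : Fin (k + 1)) =>
    isInt_lcmUpto_pow_mul_coefLiQ (hint n) b a (o := (j : ℕ)) j.isLt
  choose qT hqT using fun n (j : Fin (k + 1)) =>
    isInt_lcmUpto_pow_mul_coefThQ (hint n) b a (o := (j : ℕ)) j.isLt
  choose p hp using fun n => isInt_lcmUpto_pow_mul_constHQ (hint n) hb1 a (w := k + 1)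
  set q : ℕ → Fin ((k + 1) + (k + 1)) → ℤ := fun n => Fin.append (qL n) (qT n) with hq
  set D : ℕ → ℝ := fun n => ((Nat.lcmUpto n : ℝ)) ^ (k + 1) with hD
  have hDpos : ∀ n, 0 < D n := fun n => by
    simp only [hD]; exact pow_pos (by exact_mod_cast Nat.lcmUpto_pos n) _
  have hD1 : ∀ n, 1 ≤ D n := fun n => by
    simp only [hD]; exact one_le_pow₀ (by exact_mod_cast Nat.lcmUpto_pos n)
  have hqLR : ∀ n (j : Fin (k + 1)), (qL n j : ℝ) = D n * ((coefLiQ n (k + 1) (cf n) b a j : ℚ) : ℝ) := by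
    intro n j
    have h1 := congrArg (fun t : ℚ => (t : ℝ)) (hqL n j)
    push_cast at h1
    simp only [hD]
    linear_combination (-1 : ℝ) * h1
  have hqTR : ∀ n (j : Fin (k + 1)), (qT n j : ℝ) = D n * ((coefThQ n (k + 1) (cf n) b a j : ℚ) : ℝ) := by
    intro n j
    have h1 := congrArg (fun t : ℚ => (t : ℝ)) (hqT n j)
    push_cast at h1
    simp only [hD]
    linear_combination (-1 : ℝ) * h1
  have hpR : ∀ n, (p n : ℝ) = D n * ((constHQ n (k + 1) (cf n) b a : ℚ) : ℝ) := by
    intro n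
    have h1 := congrArg (fun t : ℚ => (t : ℝ)) (hp n)
    push_cast at h1
    simp only [hD]
    linear_combination (-1 : ℝ) * h1
  -- the value of the forms: `p_n + ∑ q_{n,i} θ_i = D_n · a^{n/2} 2^w Λ_n(a/b)`
  have hval : ∀ n, (p n : ℝ) + ∑ j, (q n j : ℝ) * θ j =
      D n * ((a : ℝ) ^ (n / 2) * ((2 : ℝ) ^ (k + 1) * formH (k + 1) n ((a : ℝ) / b))) := by
    intro n
    have e1 : ∑ j : Fin ((k + 1) + (k + 1)), (q n j : ℝ) * θ j =
        ∑ j : Fin (k + 1), (qL n j : ℝ) * Lv j + ∑ j : Fin (k + 1), (qT n j : ℝ) * Tv j := by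
      rw [Fin.sum_univ_add]
      simp only [hq, hθ, Fin.append_left, Fin.append_right]
    rw [e1, pow_mul_formH_eq_of_pfEval ha hab2 (cf n) (hev n), hpR, mul_add, mul_add, mul_sum, mul_sum,
      Finset.sum_range, Finset.sum_range]
    have eL : ∑ j : Fin (k + 1), (qL n j : ℝ) * Lv j =
        ∑ j : Fin (k + 1), D n * (((coefLiQ n (k + 1) (cf n) b a j : ℚ) : ℝ) *
          DilogPade.polylogSeries ((j : ℕ) + 1) ((a : ℝ) / b)) := by
      refine Finset.sum_congr rfl fun j _ => ?_
      rw [hqLR n j]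
      simp only [hLv]
      ring
    have eT : ∑ j : Fin (k + 1), (qT n j : ℝ) * Tv j =
        ∑ j : Fin (k + 1), D n * (((coefThQ n (k + 1) (cf n) b a j : ℚ) : ℝ) *
          oddPolylogSeries ((j : ℕ) + 1) ((a : ℝ) / b)) := by
      refine Finset.sum_congr rfl fun j _ => ?_
      rw [hqTR n j]
      simp only [hTv]
      ring
    rw [eL, eT]
    ring
  have hform_pos : ∀ n, 0 < formH (k + 1) n ((a : ℝ) / b) := fun n => formH_pos _ n hx0 hx1'
  have hapow1 : ∀ n : ℕ, (1 : ℝ) ≤ (a : ℝ) ^ (n / 2) := fun n => one_le_pow₀ haR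
  have hℓpos : ∀ n, 0 < D n * ((a : ℝ) ^ (n / 2) * ((2 : ℝ) ^ (k + 1) * formH (k + 1) n ((a : ℝ) / b))) :=
    fun n => mul_pos (hDpos n) (mul_pos (by positivity) (mul_pos (by positivity) (hform_pos n)))
  -- the same value identity, indexed by `Fin ((k+1)+k+1)` as in the transference lemma
  have hval' : ∀ n, (p n : ℝ) + ∑ j : Fin ((k + 1) + k + 1), (q n j : ℝ) * θ j =
      D n * ((a : ℝ) ^ (n / 2) * ((2 : ℝ) ^ (k + 1) * formH (k + 1) n ((a : ℝ) / b))) := fun n => hval n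
  -- `a^{n/2} ≤ exp((l_a/2) n)` and `b^{n/2} ≤ exp(((L + l_a)/2) n)` (natural division)
  have hhalf : ∀ n : ℕ, (((n / 2 : ℕ) : ℝ)) ≤ (n : ℝ) / 2 := fun n => by
    have h6 : ((n / 2 : ℕ) : ℝ) * 2 ≤ n := by exact_mod_cast Nat.div_mul_le_self n 2
    linarith only [h6]
  have hahalf : ∀ n : ℕ, (a : ℝ) ^ (n / 2) ≤ Real.exp (lA / 2 * n) := fun n => by
    rw [hapow]
    apply Real.exp_le_exp.2
    have h6 := mul_le_mul_of_nonneg_left (hhalf n) hlA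
    linarith only [h6]
  have hbhalf : ∀ n : ℕ, (b : ℝ) ^ (n / 2) ≤ Real.exp ((L + lA) / 2 * n) := fun n => by
    rw [hbpow]
    apply Real.exp_le_exp.2
    have h6 := mul_le_mul_of_nonneg_left (hhalf n) (show 0 ≤ L + lA by linarith only [hLpos, hlA])
    linarith only [h6]
  -- apply the reduction + transference in dimension `(k+1)+k = 2w − 1`
  have key := relation_trivial_of_small_forms (k := (k + 1) + k)
    (fun ξ A₁ A₂ B h1 h2 h3 h4 h5 P Q hl hu hQ => no_integer_forms ξ h1 h2 h3 h4 h5 P Q hl hu hQ)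
    θ (A₁ := wr * L + κ + 2 * δ) (A₂ := wr * L - lA / 2 - wr * (2 * l2) - wr - 2 * δ)
    (B := (L + lA) / 2 + cw + wr + 2 * δ) g0 gA gB (by rw [hkk]; exact g1)
    (by rw [hkk]; exact g2) p q ?_ ?_ ?_ cc h'
  · -- read off `a₀ = 0`, `bc = 0`, `cc' = 0` from `cc = 0`
    have hcc0 : cc = 0 := key
    refine ⟨?_, ?_, ?_⟩
    · have := congrFun hcc0 0
      simpa [hcc] using this
    · funext j
      have := congrFun hcc0 (Fin.castAdd (k + 1) j).succ
      simp only [hcc, Fin.cons_succ, Fin.append_left, Pi.zero_apply] at this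
      simpa using this
    · funext j
      have := congrFun hcc0 (Fin.natAdd (k + 1) j).succ
      simp only [hcc, Fin.cons_succ, Fin.append_right, Pi.zero_apply] at this
      simpa using this
  · -- lower bound `e^{-A₁ n} ≤ ℓ_n`
    have hfac' := eventually_exp_le_kernelH_self (k + 1) hw hδ
    have hκ' : (((k + 1 : ℕ) : ℝ) * ((2 * ((k + 1 : ℕ) : ℝ) + 1) *
        Real.log ((2 * ((k + 1 : ℕ) : ℝ) + 1) / (2 * ((k + 1 : ℕ) : ℝ))) - Real.log 2)) = κ := by
      rw [hκdef, hwrdef, hl2def]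
    filter_upwards [hfac', DilogPade.eventually_const_le_mul L hδ] with n hfac hLn
    rw [hval' n, abs_of_pos (hℓpos n)]
    have hfac2 : Real.exp (-((κ + δ) * n)) ≤
        (4 : ℝ) ^ ((k + 1) * n) * (((k + 1) * n).factorial : ℝ) *
          (((2 * (k + 1) * n).factorial : ℝ) ^ (k + 1)) /
            ((((2 * (k + 1) + 1) * n + 1).factorial : ℝ) ^ (k + 1)) := by
      have := hfac
      rw [hκ'] at this
      convert this using 2
    have h2w : (1 : ℝ) ≤ (2 : ℝ) ^ (k + 1) := one_le_pow₀ (by norm_num)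
    calc Real.exp (-((wr * L + κ + 2 * δ) * n))
        ≤ Real.exp (-((κ + δ) * n)) * Real.exp (-(L * ((((k + 1) * n + 1 : ℕ) : ℝ)))) := by
          rw [← Real.exp_add]
          apply Real.exp_le_exp.2
          rw [hwrk]
          push_cast
          linear_combination hLn
      _ ≤ (4 : ℝ) ^ ((k + 1) * n) * (((k + 1) * n).factorial : ℝ) *
            (((2 * (k + 1) * n).factorial : ℝ) ^ (k + 1)) /
            ((((2 * (k + 1) + 1) * n + 1).factorial : ℝ) ^ (k + 1)) *
            ((a : ℝ) / b) ^ ((k + 1) * n + 1) := by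
          rw [hypow]
          exact mul_le_mul_of_nonneg_right hfac2 (Real.exp_pos _).le
      _ ≤ formH (k + 1) n ((a : ℝ) / b) := formH_ge _ n hx0.le hx1'
      _ ≤ (2 : ℝ) ^ (k + 1) * formH (k + 1) n ((a : ℝ) / b) :=
          le_mul_of_one_le_left (hform_pos n).le h2w
      _ ≤ (a : ℝ) ^ (n / 2) * ((2 : ℝ) ^ (k + 1) * formH (k + 1) n ((a : ℝ) / b)) :=
          le_mul_of_one_le_left (mul_pos (by positivity) (hform_pos n)).le (hapow1 n)
      _ ≤ D n * ((a : ℝ) ^ (n / 2) * ((2 : ℝ) ^ (k + 1) * formH (k + 1) n ((a : ℝ) / b))) :=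
          le_mul_of_one_le_left (mul_pos (by positivity) (mul_pos (by positivity) (hform_pos n))).le
            (hD1 n)
  · -- upper bound `ℓ_n ≤ e^{-A₂ n}`
    have hDev := Literature.NumberTheory.Transcendental.eventually_lcmUpto_mul_pow_le_exp 1 (k + 1) hδ
    filter_upwards [hDev, DilogPade.eventually_const_le_exp_mul ((2 : ℝ) ^ (k + 1)) hδ]
      with n hDn h2n
    rw [one_mul] at hDn
    push_cast at hDn
    rw [hval' n, abs_of_pos (hℓpos n)]
    have hform_le : formH (k + 1) n ((a : ℝ) / b) ≤
        (4 : ℝ) ^ ((k + 1) * n) * ((a : ℝ) / b) ^ ((k + 1) * n) := formH_le _ n hx0.le hx1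
    have hDle : D n ≤ Real.exp ((((k : ℝ) + 1) + δ) * n) := by
      simp only [hD]
      have := hDn
      simp only [one_mul] at this
      exact_mod_cast this
    calc D n * ((a : ℝ) ^ (n / 2) * ((2 : ℝ) ^ (k + 1) * formH (k + 1) n ((a : ℝ) / b)))
        ≤ Real.exp ((((k : ℝ) + 1) + δ) * n) * (Real.exp (lA / 2 * n) *
            (Real.exp (δ * n) * ((4 : ℝ) ^ ((k + 1) * n) * ((a : ℝ) / b) ^ ((k + 1) * n)))) := by
          have hnn : (0 : ℝ) ≤ (2 : ℝ) ^ (k + 1) * formH (k + 1) n ((a : ℝ) / b) :=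
            (mul_pos (by positivity) (hform_pos n)).le
          refine mul_le_mul hDle ?_ (mul_nonneg (by positivity) hnn) (Real.exp_pos _).le
          refine mul_le_mul (hahalf n) ?_ hnn (Real.exp_pos _).le
          exact mul_le_mul h2n hform_le (hform_pos n).le (Real.exp_pos _).le
      _ = Real.exp (-((wr * L - lA / 2 - wr * (2 * l2) - wr - 2 * δ) * n)) := by
          rw [h4pow, hypow, ← Real.exp_add, ← Real.exp_add, ← Real.exp_add, ← Real.exp_add]
          congr 1
          rw [hwrk]
          push_cast
          ring
  · -- coefficients `|q_{n,j}| ≤ e^{B n}`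
    have hDev := Literature.NumberTheory.Transcendental.eventually_lcmUpto_mul_pow_le_exp 1 (k + 1) hδ
    filter_upwards [hDev, DilogPade.eventually_const_le_exp_mul
      (((k + 1).factorial : ℝ) * (2 : ℝ) ^ (k + 1) * (2 : ℝ) ^ (k + 1)) hδ] with n hDn hfact j
    rw [one_mul] at hDn
    push_cast at hDn
    have hDle : D n ≤ Real.exp ((((k : ℝ) + 1) + δ) * n) := by
      simp only [hD]
      have := hDn
      simp only [one_mul] at this
      exact_mod_cast this
    -- the `ℓ¹` bound of the partial-fraction data
    have hl1' : BallRivoal.l1 n (k + 1) (cf n) ≤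
        ((k + 1).factorial : ℚ) * (2 : ℚ) ^ ((k + 1) * ((2 * (k + 1) + 3) * n + 1)) :=
      (hl1 n).trans (mul_le_mul_of_nonneg_left (prod_two_pow_le (k + 1) n) (by positivity))
    -- the size of the `j`-th coefficient over `ℚ`, uniformly for both halves
    have hco : ∀ i : Fin ((k + 1) + (k + 1)), |(q n i : ℝ)| ≤ D n *
        (((k + 1).factorial : ℝ) * (2 : ℝ) ^ ((k + 1) * ((2 * (k + 1) + 3) * n + 1)) *
          (2 : ℝ) ^ (k + 1) * (b : ℝ) ^ (n / 2)) := by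
      intro i
      have hbound : ∀ X : ℚ, |X| ≤ BallRivoal.l1 n (k + 1) (cf n) * 2 ^ (k + 1) * (b : ℚ) ^ (n / 2) →
          |((X : ℚ) : ℝ)| ≤ ((k + 1).factorial : ℝ) *
            (2 : ℝ) ^ ((k + 1) * ((2 * (k + 1) + 3) * n + 1)) * (2 : ℝ) ^ (k + 1) * (b : ℝ) ^ (n / 2) := by
        intro X hX
        have h3 : |X| ≤ ((k + 1).factorial : ℚ) * (2 : ℚ) ^ ((k + 1) * ((2 * (k + 1) + 3) * n + 1)) *
            2 ^ (k + 1) * (b : ℚ) ^ (n / 2) :=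
          hX.trans (mul_le_mul_of_nonneg_right (mul_le_mul_of_nonneg_right hl1' (by positivity))
            (by positivity))
        have h4 := (Rat.cast_le (K := ℝ)).2 h3
        push_cast at h4
        exact h4
      induction i using Fin.addCases with
      | left j =>
        have e : q n (Fin.castAdd (k + 1) j) = qL n j := by simp only [hq, Fin.append_left]
        rw [e, hqLR n j, abs_mul, abs_of_pos (hDpos n)]
        exact mul_le_mul_of_nonneg_left (hbound _ (abs_coefLiQ_le (cf n) ha hab j.isLt)) (hDpos n).le
      | right j =>
        have e : q n (Fin.natAdd (k + 1) j) = qT n j := by simp only [hq, Fin.append_right]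
        rw [e, hqTR n j, abs_mul, abs_of_pos (hDpos n)]
        exact mul_le_mul_of_nonneg_left (hbound _ (abs_coefThQ_le (cf n) ha hab j.isLt)) (hDpos n).le
    refine (hco j).trans ?_
    calc D n * (((k + 1).factorial : ℝ) * (2 : ℝ) ^ ((k + 1) * ((2 * (k + 1) + 3) * n + 1)) *
          (2 : ℝ) ^ (k + 1) * (b : ℝ) ^ (n / 2))
        = D n * ((((k + 1).factorial : ℝ) * (2 : ℝ) ^ (k + 1) * (2 : ℝ) ^ (k + 1)) *
            ((2 : ℝ) ^ ((k + 1) * ((2 * (k + 1) + 3) * n)) * (b : ℝ) ^ (n / 2))) := by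
          rw [show (k + 1) * ((2 * (k + 1) + 3) * n + 1) = (k + 1) * ((2 * (k + 1) + 3) * n) + (k + 1)
            by ring, pow_add]
          ring
      _ ≤ Real.exp ((((k : ℝ) + 1) + δ) * n) *
            (Real.exp (δ * n) * (Real.exp (l2 * (((k + 1) * ((2 * (k + 1) + 3) * n) : ℕ) : ℝ)) *
              Real.exp ((L + lA) / 2 * n))) := by
          refine mul_le_mul hDle ?_ (by positivity) (Real.exp_pos _).le
          refine mul_le_mul hfact ?_ (by positivity) (Real.exp_pos _).le
          exact mul_le_mul (le_of_eq (h2pow _)) (hbhalf n) (by positivity) (Real.exp_pos _).le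
      _ = Real.exp ((((L + lA) / 2 + cw + wr + 2 * δ)) * n) := by
          rw [← Real.exp_add, ← Real.exp_add, ← Real.exp_add]
          congr 1
          rw [hcwdef, hwrk]
          push_cast
          ring

end ParityPade

open ParityPade in
/-- **Linear independence of `1, Li_s(a/b), Θ_s(a/b)` (`1 ≤ s ≤ w`) over `ℚ`** for `w ≥ 1`, `a ≥ 1` and
`log b ≥ 8(w+1)³ + 4w log a`: every rational relation
`r + ∑_{j<w} u_j Li_{j+1}(a/b) + ∑_{j<w} v_j Θ_{j+1}(a/b) = 0` is trivial.
[cite: DavidHirataKohnoKawashima2020, Thm 2.1] -/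
theorem one_polylog_oddPolylog_linearIndependent_rat (w : ℕ) (hw : 1 ≤ w) (a b : ℕ) (ha : 1 ≤ a)
    (hb : 8 * ((w : ℝ) + 1) ^ 3 + 4 * w * Real.log a ≤ Real.log b) (r : ℚ) (u v : Fin w → ℚ)
    (h : (r : ℝ) + ∑ j : Fin w, (u j : ℝ) * DilogPade.polylogSeries ((j : ℕ) + 1) ((a : ℝ) / b) +
      ∑ j : Fin w, (v j : ℝ) * oddPolylogSeries ((j : ℕ) + 1) ((a : ℝ) / b) = 0) :
    r = 0 ∧ u = 0 ∧ v = 0 := by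
  classical
  -- a common denominator and the integer coefficients
  set d : ℕ := r.den * ((∏ i, (u i).den) * ∏ i, (v i).den) with hd
  have hdpos : 0 < d := Nat.mul_pos r.den_pos
    (Nat.mul_pos (Finset.prod_pos fun i _ => (u i).den_pos) (Finset.prod_pos fun i _ => (v i).den_pos))
  have hclear : ∀ t : ℚ, t.den ∣ d → ∃ z : ℤ, (d : ℚ) * t = z := by
    intro t ht
    obtain ⟨e, he⟩ := ht
    refine ⟨(e : ℤ) * t.num, ?_⟩
    have h1 : (d : ℚ) = (t.den : ℚ) * e := by exact_mod_cast he
    rw [h1, mul_comm (t.den : ℚ), mul_assoc, Rat.den_mul_eq_num]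
    push_cast
    ring
  have hdr : r.den ∣ d := Dvd.intro _ rfl
  have hdu : ∀ i, (u i).den ∣ d := fun i =>
    (Finset.dvd_prod_of_mem (fun i => (u i).den) (mem_univ i)).trans
      ((Dvd.intro _ rfl : (∏ i, (u i).den) ∣ (∏ i, (u i).den) * ∏ i, (v i).den).trans
        (Dvd.intro_left _ rfl))
  have hdv : ∀ i, (v i).den ∣ d := fun i =>
    (Finset.dvd_prod_of_mem (fun i => (v i).den) (mem_univ i)).trans
      ((Dvd.intro_left _ rfl : (∏ i, (v i).den) ∣ (∏ i, (u i).den) * ∏ i, (v i).den).trans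
        (Dvd.intro_left _ rfl))
  obtain ⟨r', hr'⟩ := hclear r hdr
  choose u' hu' using fun i => hclear (u i) (hdu i)
  choose v' hv' using fun i => hclear (v i) (hdv i)
  have castR : ∀ (t : ℚ) (z : ℤ), (d : ℚ) * t = z → (z : ℝ) = (d : ℝ) * t := fun t z hz => by
    have := congrArg (fun t : ℚ => (t : ℝ)) hz
    push_cast at this
    linarith
  have hrel : (r' : ℝ) + ∑ j : Fin w, (u' j : ℝ) *
      DilogPade.polylogSeries ((j : ℕ) + 1) ((a : ℝ) / b) +
      ∑ j : Fin w, (v' j : ℝ) * oddPolylogSeries ((j : ℕ) + 1) ((a : ℝ) / b) = 0 := by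
    have eu : ∑ j : Fin w, (u' j : ℝ) * DilogPade.polylogSeries ((j : ℕ) + 1) ((a : ℝ) / b) =
        (d : ℝ) * ∑ j : Fin w, (u j : ℝ) * DilogPade.polylogSeries ((j : ℕ) + 1) ((a : ℝ) / b) := by
      rw [Finset.mul_sum]
      exact Finset.sum_congr rfl fun j _ => by rw [castR (u j) (u' j) (hu' j)]; ring
    have ev : ∑ j : Fin w, (v' j : ℝ) * oddPolylogSeries ((j : ℕ) + 1) ((a : ℝ) / b) =
        (d : ℝ) * ∑ j : Fin w, (v j : ℝ) * oddPolylogSeries ((j : ℕ) + 1) ((a : ℝ) / b) := by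
      rw [Finset.mul_sum]
      exact Finset.sum_congr rfl fun j _ => by rw [castR (v j) (v' j) (hv' j)]; ring
    rw [castR r r' hr', eu, ev]
    have := congrArg (fun t => (d : ℝ) * t) h
    simp only [mul_zero] at this
    linear_combination this
  obtain ⟨h0, h1, h2⟩ := ParityPade.intRelation_trivial_rat w hw a b ha hb r' u' v' hrel
  have hd0 : (d : ℚ) ≠ 0 := by exact_mod_cast hdpos.ne'
  refine ⟨?_, ?_, ?_⟩
  · have e : (d : ℚ) * r = 0 := by rw [hr', h0]; simp
    simpa [hd0] using e
  · funext i
    have e : (d : ℚ) * u i = 0 := by rw [hu' i, congrFun h1 i]; simp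
    simpa [hd0] using e
  · funext i
    have e : (d : ℚ) * v i = 0 := by rw [hv' i, congrFun h2 i]; simp
    simpa [hd0] using e

end Literature.NumberTheory.DiophantineApproximation
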